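/-
Copyright: the b2b-balaban T⁴-continuum CRUX team, row NE7b OWNER lineage `t4-ne7b-p1` (gen 123). Project licence.
-/
import Summits.QuantumFields.BalabanUV.T4Continuum.Spine.NE7b.SupZdPropagatorRegularity
import Summits.QuantumFields.BalabanUV.T4Continuum.Spine.NE7b.SupTorusCoarseFloor

/-!
# THE INFINITE-VOLUME COARSE OPERATOR OF THE ROAD'S CLASS: on `ℤ^d`, with the bounded block columns `Ψ_{b′}` (`H_VΨ_{b′} = 𝟙_{B n b′}`,
# unique by (181)), the Schur-complement entries `T_∞(b, b′) = (n+1)^{−d}Σ_{q ∈ B n b}Ψ_{b′}(q)` DECAY, `|T_∞(b,b′)| ≤ C·e^{−δ|b − b′|₁}`, are the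
# limits of the torus Schur complements along the tower, and inherit [B6] (2.76)'s COARSE FLOOR `Σ_b g b²∕(36^d(4d + a + Λ)) ≤
# Σ_{b,b′} g b·T_∞(b,b′)·g b′` for every finitely supported coarse `g` — (135) `coarse_floor` at every level, the block-source window reading,
# and (184)'s tower limit (row NE7b, node U5c; (135)∕(148)∕(180)∕(181)∕(184) BY NAME; [folklore])

Cell `pub-balaban`, sub-cell `t4`, spine estimate NE7b (`T4WeightBudget.RelWeightBound`; the cell's OWN estimate — NOT PRINTED in
[Bałaban 1983–89], NOT PROVED).  Crux-route work under `Spine/NE7b/` by the row OWNER (`t4-ne7b-p1` gen 123, file (186)) under FREEZE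
(0)'s crux-prover clause; NOTHING of Bałaban's is named as a Lean object, valued or asserted; no `T4Continuum/Support` leaf typed; no `def`,
no notation (the `ℤ^d` operator, the torus action and every Schur-complement entry DISPLAYED; `T_∞` is not defined — statements are about
the displayed block means of ANY bounded block columns); zero `sorry`.  Imports (BY NAME): the OWNER's (184) `…SupZdPropagatorRegularity`
(`bounded_solution_is_tower_limit`; through it (181) `zd_bounded_solution_unique`, (180) `zd_propagator_exists`, `inWindow_of_le`, (179)
`abs_le_side_mul`, (148) `action_surjective`, `exists_blockColumns`, (133) `action_injective`, the window kit), (135) `…SupTorusCoarseFloor`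
(`coarse_floor`).

WHY (located).  The road's next-scale Hessian is `(n+1)^d T⁻¹` ((102)∕(136)); on `ℤ^d` its first ingredient is the coarse operator `T_∞ =
Q′H_∞⁻¹Q′*` — the block means of the block columns of the infinite-volume propagator (180)∕(181).  Its entries decay by (180); they are the
limits of the torus entries because the torus block column of `σ_k b′` solves the torus equation with the WINDOW READING of the `ℤ^d` block
source `𝟙_{B n b′}` once `b′` is inside the coarse window (§1: `σ(blk n (wm x)) = σ b′ ↔ blk n (wm x) = b′`), so (184) identifies its lift's
limit with `Ψ_{b′}`; and (135)'s floor, a statement about finite sums over the support of `g` once the support is inside the window (§1's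
reindexing `Σ_y F(wm y) = Σ_{b ∈ S}F b`), passes to the limit.

WHAT IS PROVED ([folklore]; `X d = ℤ^d`, `T_k = Site d ((n+1)3^k)`, coarse `Site d (3^k)`; `σ`, `wm` projections and centred window maps;
the `ℤ^d` operator and the torus action DISPLAYED; `Ψ : X d → X d → ℝ` ANY family with `H_VΨ_{b′} = 𝟙[blk n · = b′]` and `|Ψ_{b′}| ≤ B_{b′}`):
* §1 `sum_window_reading` (`S` inside the window, `F = 0` off `S` ⟹ `Σ_y F(wm y) = Σ_{b ∈ S}F b`), `blockSource_window_reading`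
  (`2|b′|₁ + 2 ≤ k` ⟹ `σ_k(blk n (wm_k x)) = σ_k b′ ↔ blk n (wm_k x) = b′`).
* §2 **`zd_coarse_entry_decay`** (`∃ C δ > 0` from `(d, a, λ, Λ)`: `|(n+1)^{−d}Σ_{q ∈ B n b}Ψ_{b′} q| ≤ C·e^{−δ|b − b′|₁}`);
  **`zd_coarse_entry_tendsto`** (for the torus block columns `ψ^k` of `V∘wm_k`: `T_k(σ_k b, σ_k b′) → (n+1)^{−d}Σ_{q ∈ B n b}Ψ_{b′} q`).
* §3 **`zd_coarse_floor`** (`d ≥ 3`, `a > 0`, `λ < min(2,a)`, `Λ ≥ 0`, `V : ℤ^d → [−λ, Λ]`, `g` vanishing off a finite `S`: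
  `(1∕(36^d(4d + a + Λ)))Σ_{b ∈ S} g b² ≤ Σ_{b ∈ S} g b·Σ_{b′ ∈ S}((n+1)^{−d}Σ_{q ∈ B n b}Ψ_{b′} q)·g b′`).
* §4 toy (`d = 3`).

HONEST (what this is NOT).  Entries, decay and floor of `T_∞` only — its inverse on `ℓ²(ℤ^d)`∕`ℓ^∞(ℤ^d)` (the infinite-volume next-scale
Hessian) and its locality are the sequel (Lax–Milgram ∕ (134)'s Combes–Thomas on `ℤ^d`); `d ≥ 3` only; the LINEAR column only; scalar
skeleton ((A3), NC-NE7b-α UNRULED); nothing of the covariant propagators of [B4]–[B6]; [B6] (2.76) is the printed MODEL of the floor — locator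
only, nothing of it asserted; nothing of Bałaban's.  BY-NAME EFFECT ON THE WALL: NONE.  NE7b NOT PRINTED ∕ NOT PROVED; spine PROVED 0∕9;
rung (B)+1 — the programme's measures remain FINITE-torus statements; NOT the mass gap, NOT Clay.  HONEST DEPENDENCY: continuum YM on T⁴ ⇐
BetaPertH ∧ nine spine estimates (0∕9 proved); BetaPertH ⇐ (D1) ∧ (D4) ∧ CAP+tail; G-an2-4 gates asym, D1 and NE2∕3∕4.
-/

set_option autoImplicit false

noncomputable section

namespace Summit.QuantumFields.BalabanUV.T4Continuum.NE7b.SupZdCoarseOperator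

open Real Filter Topology
open Literature.MathematicalPhysics.QuantumFieldTheory.Balaban1983to89
open B6QGQLower276 (X e blk B side side_facts chart mem_B sum_B sum_B_const card_cube blk_chart)
open Beta (Site siteOf windowMap siteOf_windowMap siteOf_add siteOf_sub InWindow windowMap_siteOf inWindow_windowMap
  inWindow_of_two_mul_abs_lt)
open SupTorusActionForm (action_injective)
open SupTorusSupNormBound (action_surjective exists_blockColumns)
open SupTorusCoarseFloor (coarse_floor)
open SupTorusTowerComparison (abs_le_side_mul)
open SupZdPropagatorLimit (zd_propagator_exists inWindow_of_le)
open SupZdPropagatorUniqueness (zd_bounded_solution_unique)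
open SupZdPropagatorRegularity (bounded_solution_is_tower_limit)

variable {d : ℕ}

/-! ## §1. Finite sums and block sources read through the window -/

/-- **A SUM OVER THE TORUS OF A WINDOW READING IS THE SUM OVER THE SUPPORT**: if `F = 0` off the finite set `S` and `S` lies inside the
window (`wm(σ b) = b` on `S`), then `Σ_y F(wm y) = Σ_{b ∈ S} F b`. [folklore] -/
theorem sum_window_reading (N : ℕ) [NeZero N] (S : Finset (X d)) (hS : ∀ b ∈ S, windowMap d N (siteOf d N b) = b)
    (F : X d → ℝ) (hF : ∀ b, b ∉ S → F b = 0) : ∑ y : Site d N, F (windowMap d N y) = ∑ b ∈ S, F b := by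
  classical
  have h1 : ∑ b ∈ S, F b = ∑ b ∈ S, F (windowMap d N (siteOf d N b)) := Finset.sum_congr rfl fun b hb => by rw [hS b hb]
  have h2 : ∑ b ∈ S, F (windowMap d N (siteOf d N b)) = ∑ y ∈ S.image (siteOf d N), F (windowMap d N y) :=
    (Finset.sum_image (f := fun y => F (windowMap d N y)) fun b hb b' hb' h => by
      have := congrArg (windowMap d N) h
      rwa [hS b hb, hS b' hb'] at this).symm
  have h3 : ∑ y ∈ S.image (siteOf d N), F (windowMap d N y) = ∑ y, F (windowMap d N y) :=
    Finset.sum_subset (Finset.subset_univ _) fun y _ hy =>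
      hF _ fun hmem => hy (Finset.mem_image.2 ⟨_, hmem, by rw [siteOf_windowMap]⟩)
  rw [h1, h2, h3]

/-- **THE TORUS BLOCK SOURCE OF `σ_k b′` IS THE WINDOW READING OF THE `ℤ^d` BLOCK SOURCE `𝟙_{B n b′}`** once `b′` is inside the coarse window:
`2|b′|₁ + 2 ≤ k` ⟹ for every `x ∈ T_k`, `σ_k(blk n (wm_k x)) = σ_k b′ ↔ blk n (wm_k x) = b′` (the block of a window representative has
`|2·blk n (wm x) i| ≤ 3^k + 1`, so congruence mod `3^k` to the small `b′ i` is equality). [folklore] -/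
theorem blockSource_window_reading (n k : ℕ) (b' : X d) (hk : 2 * ∑ i, (b' i).natAbs + 2 ≤ k) (x : Site d ((n + 1) * 3 ^ k)) :
    siteOf d (3 ^ k) (blk n (windowMap d ((n + 1) * 3 ^ k) x)) = siteOf d (3 ^ k) b' ↔ blk n (windowMap d ((n + 1) * 3 ^ k) x) = b' := by
  classical
  refine ⟨fun h => ?_, fun h => by rw [h]⟩
  have hs : (0 : ℤ) < side n := (side_facts n).1
  have hside : side n = (n : ℤ) + 1 := rfl
  have hpow : k < 3 ^ k := Nat.lt_pow_self (by norm_num)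
  set q : X d := windowMap d ((n + 1) * 3 ^ k) x with hq
  funext i
  have hcong : (((blk n q i : ℤ)) : ZMod (3 ^ k)) = (((b' i : ℤ)) : ZMod (3 ^ k)) := congrFun h i
  obtain ⟨m, hm⟩ := (ZMod.intCast_eq_intCast_iff_dvd_sub (blk n q i) (b' i) (3 ^ k)).1 hcong
  -- `|2·blk n q i| ≤ 3^k + 1`
  obtain ⟨-, hr0, hr1, hqeq⟩ := abs_le_side_mul n q i
  obtain ⟨hw1, hw2⟩ := inWindow_windowMap x i
  rw [← hq] at hw1 hw2
  push_cast at hw1 hw2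
  set b : ℤ := blk n q i with hb
  have h2b_le : 2 * b ≤ ((3 ^ k : ℕ) : ℤ) := by
    have h' : side n * (2 * b) ≤ side n * ((3 ^ k : ℕ) : ℤ) := by rw [hside]; push_cast; nlinarith
    exact le_of_mul_le_mul_left h' hs
  have h2b_ge : -(((3 ^ k : ℕ) : ℤ)) - 1 ≤ 2 * b := by
    have h' : side n * (-(((3 ^ k : ℕ) : ℤ))) < side n * (2 * (b + 1)) := by rw [hside]; push_cast; nlinarith
    have := lt_of_mul_lt_mul_left h' hs.le
    linarith
  -- `|b′ i|` is small
  have hbi : 2 * ((b' i).natAbs : ℤ) + 2 ≤ k := by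
    have h1 : (b' i).natAbs ≤ ∑ j, (b' j).natAbs :=
      Finset.single_le_sum (f := fun j => (b' j).natAbs) (fun _ _ => Nat.zero_le _) (Finset.mem_univ i)
    have : 2 * (b' i).natAbs + 2 ≤ k := by omega
    exact_mod_cast this
  rw [Int.natCast_natAbs] at hbi
  have hkpow : (k : ℤ) < ((3 ^ k : ℕ) : ℤ) := by exact_mod_cast hpow
  -- the multiple is zero
  by_contra hne
  have hm0 : m ≠ 0 := by
    intro hm0; rw [hm0, mul_zero, sub_eq_zero] at hm; exact hne hm.symm
  have hm1 : 1 ≤ |m| := Int.one_le_abs hm0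
  have hN0 : (0 : ℤ) ≤ ((3 ^ k : ℕ) : ℤ) := by positivity
  have hNm : ((3 ^ k : ℕ) : ℤ) ≤ |(((3 ^ k : ℕ) : ℤ)) * m| := by
    rw [abs_mul, abs_of_nonneg hN0]; exact le_mul_of_one_le_right hN0 hm1
  have hbv : |(((3 ^ k : ℕ) : ℤ)) * m| ≤ |b' i| + |b| := by rw [← hm]; exact abs_sub _ _
  have hb2 : |2 * b| ≤ ((3 ^ k : ℕ) : ℤ) + 1 := abs_le.2 ⟨by linarith, by linarith⟩
  rw [abs_mul, abs_two] at hb2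
  linarith

/-! ## §2. The entries of the infinite-volume coarse operator: decay, and limits of the torus entries -/

/-- **THE ENTRIES OF `T_∞` DECAY**: `∃ C δ > 0` from `(d, a, λ, Λ)` such that for ALL `n`, `V : ℤ^d → [−λ, Λ]` and ANY bounded block columns
`Ψ_{b′}` (`H_VΨ_{b′} = 𝟙[blk n · = b′]`): `|(n+1)^{−d}Σ_{q ∈ B n b}Ψ_{b′} q| ≤ C·e^{−δ|b − b′|₁}` — `Ψ_{b′}` IS (180)'s decaying propagator ((181)),
and every `q ∈ B n b` has `blk n q = b`. [folklore] -/
theorem zd_coarse_entry_decay (hd : 3 ≤ d) (a : ℝ) (ha : 0 < a) {lam Lam : ℝ} (hlam : lam < min 2 a) (hLam : 0 ≤ Lam) :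
    ∃ C δ : ℝ, 0 < C ∧ 0 < δ ∧ ∀ (n : ℕ) (V : X d → ℝ), (∀ p, -lam ≤ V p) → (∀ p, V p ≤ Lam) →
      ∀ (Ψ : X d → X d → ℝ) (BΨ : X d → ℝ), (∀ b' p, |Ψ b' p| ≤ BΨ b') →
      (∀ b' p, ((n : ℝ) + 1) ^ 2 * ∑ μ, (2 * Ψ b' p - Ψ b' (p + e μ) - Ψ b' (p - e μ))
        + a / ((n : ℝ) + 1) ^ d * ∑ q ∈ B n (blk n p), Ψ b' q + V p * Ψ b' p = if blk n p = b' then 1 else 0) →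
      ∀ b b' : X d, |(((n : ℝ) + 1) ^ d)⁻¹ * ∑ q ∈ B n b, Ψ b' q| ≤ C * exp (-(δ * ∑ i, (((b i - b' i).natAbs : ℕ) : ℝ))) := by
  classical
  obtain ⟨C, δ, hC, hδ, H180⟩ := zd_propagator_exists (d := d) hd a ha hlam hLam
  refine ⟨C, δ, hC, hδ, ?_⟩
  intro n V hV hV' Ψ BΨ hΨB hΨ b b'
  have hvol : (0 : ℝ) < ((n : ℝ) + 1) ^ d := by positivity
  -- `Ψ_{b′}` is (180)'s decaying solution
  obtain ⟨v, hveq, hvdec⟩ := H180 n V hV hV' b' 1 (fun p => if blk n p = b' then (1 : ℝ) else 0)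
    (fun p hp => by rw [if_neg hp]) (fun p => by split_ifs <;> simp)
  have hvB : ∀ p, |v p| ≤ C * 1 := fun p => by
    have h := hvdec p
    have h1 : (1 : ℝ) ≤ exp (δ * ∑ i, (((blk n p i - b' i).natAbs : ℕ) : ℝ)) := one_le_exp (by positivity)
    nlinarith [abs_nonneg (v p)]
  have hΨv : Ψ b' = v := zd_bounded_solution_unique hd a ha hlam hLam n V hV hV' _ (Ψ b') v (hΨB b') hvB (hΨ b') hveq
  -- every `q ∈ B n b` carries `e^{−δ|b − b′|₁}`
  have hq : ∀ q ∈ B n b, |Ψ b' q| ≤ C * exp (-(δ * ∑ i, (((b i - b' i).natAbs : ℕ) : ℝ))) := fun q hqB => by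
    have h := hvdec q
    rw [← hΨv, mem_B.1 hqB, mul_one] at h
    have hE := exp_pos (δ * ∑ i, (((b i - b' i).natAbs : ℕ) : ℝ))
    rw [exp_neg, ← div_eq_mul_inv, le_div_iff₀ hE, mul_comm]; exact h
  rw [abs_mul, abs_inv, abs_of_pos hvol, inv_mul_le_iff₀ hvol]
  calc |∑ q ∈ B n b, Ψ b' q| ≤ ∑ q ∈ B n b, |Ψ b' q| := Finset.abs_sum_le_sum_abs _ _
    _ ≤ ∑ _q ∈ B n b, C * exp (-(δ * ∑ i, (((b i - b' i).natAbs : ℕ) : ℝ))) := Finset.sum_le_sum hq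
    _ = ((n : ℝ) + 1) ^ d * (C * exp (-(δ * ∑ i, (((b i - b' i).natAbs : ℕ) : ℝ)))) := sum_B_const _ _

/-- **THE TORUS SCHUR-COMPLEMENT ENTRIES CONVERGE TO THE `ℤ^d` ENTRIES**: for the torus block columns `ψ^k` of `H[V∘wm_k]` on `T_k` and ANY
bounded `ℤ^d` block columns `Ψ`: `T_k(σ_k b, σ_k b′) = (n+1)^{−d}Σ_z ψ^k_{σ_k b′}(σ_k(chart n (wm_k(σ_k b)) z)) → (n+1)^{−d}Σ_{q ∈ B n b}Ψ_{b′} q` —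
beyond the window radius of `b, b′`, `ψ^k_{σ_k b′}` is the torus solution with the window reading of `𝟙_{B n b′}` (§1 + (133) uniqueness),
whose lift converges to `Ψ_{b′}` ((184)). [folklore] -/
theorem zd_coarse_entry_tendsto (hd : 3 ≤ d) (a : ℝ) (ha : 0 < a) {lam Lam : ℝ} (hlam : lam < min 2 a) (hLam : 0 ≤ Lam)
    (n : ℕ) (V : X d → ℝ) (hV : ∀ p, -lam ≤ V p) (hV' : ∀ p, V p ≤ Lam)
    (Ψ : X d → X d → ℝ) (BΨ : X d → ℝ) (hΨB : ∀ b' p, |Ψ b' p| ≤ BΨ b')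
    (hΨ : ∀ b' p, ((n : ℝ) + 1) ^ 2 * ∑ μ, (2 * Ψ b' p - Ψ b' (p + e μ) - Ψ b' (p - e μ))
      + a / ((n : ℝ) + 1) ^ d * ∑ q ∈ B n (blk n p), Ψ b' q + V p * Ψ b' p = if blk n p = b' then 1 else 0)
    (ψ : (k : ℕ) → Site d (3 ^ k) → Site d ((n + 1) * 3 ^ k) → ℝ)
    (hψ : ∀ (k : ℕ) (y' : Site d (3 ^ k)) (x : Site d ((n + 1) * 3 ^ k)),
      ((n : ℝ) + 1) ^ 2 * ∑ μ, (2 * ψ k y' x - ψ k y' (x + siteOf d ((n + 1) * 3 ^ k) (e μ)) - ψ k y' (x - siteOf d ((n + 1) * 3 ^ k) (e μ)))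
        + a / ((n : ℝ) + 1) ^ d * ∑ q ∈ B n (blk n (windowMap d ((n + 1) * 3 ^ k) x)), ψ k y' (siteOf d ((n + 1) * 3 ^ k) q)
        + V (windowMap d ((n + 1) * 3 ^ k) x) * ψ k y' x
        = if siteOf d (3 ^ k) (blk n (windowMap d ((n + 1) * 3 ^ k) x)) = y' then 1 else 0)
    (b b' : X d) :
    Tendsto (fun k => (((n : ℝ) + 1) ^ d)⁻¹ * ∑ z : Fin d → Fin (n + 1),
        ψ k (siteOf d (3 ^ k) b') (siteOf d ((n + 1) * 3 ^ k) (chart n (windowMap d (3 ^ k) (siteOf d (3 ^ k) b)) z))) atTop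
      (𝓝 ((((n : ℝ) + 1) ^ d)⁻¹ * ∑ q ∈ B n b, Ψ b' q)) := by
  classical
  have hm0 : 0 < min 2 a - lam := by linarith
  -- the torus solutions with the window reading of the `ℤ^d` block source, at every level
  set f : X d → ℝ := fun p => if blk n p = b' then 1 else 0 with hf
  have hfM : ∀ p, |f p| ≤ 1 := fun p => by simp only [hf]; split_ifs <;> simp
  choose w hw using fun k : ℕ => action_surjective n a (3 ^ k) ha.le hm0 (fun x => V (windowMap d ((n + 1) * 3 ^ k) x))
    (fun x => hV _) (fun x => f (windowMap d ((n + 1) * 3 ^ k) x))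
  have hlim := bounded_solution_is_tower_limit hd a ha hlam hLam n V hV hV' f hfM (Ψ b') (hΨB b') (hΨ b') w hw
  -- beyond the window radius of `b′`, the block column of `σ_k b′` IS that torus solution ((133) uniqueness)
  set k₁ : ℕ := 2 * ∑ i, (b' i).natAbs + 2 with hk₁
  have hcol : ∀ k, k₁ ≤ k → ψ k (siteOf d (3 ^ k) b') = w k := by
    intro k hk
    refine action_injective n a (3 ^ k) ha.le hm0 (fun x => V (windowMap d ((n + 1) * 3 ^ k) x)) (fun x => hV _) _ _ fun x => ?_
    rw [hψ k (siteOf d (3 ^ k) b') x, hw k x]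
    simp only [hf, blockSource_window_reading n k b' (by rw [hk₁] at hk; exact hk) x]
  -- beyond the window radius of `b`, the block of `σ_k b` reads `B n b`
  set k₂ : ℕ := 2 * ∑ i, (b i).natAbs + 1 with hk₂
  have hblock : ∀ k, k₂ ≤ k → windowMap d (3 ^ k) (siteOf d (3 ^ k) b) = b := fun k hk =>
    windowMap_siteOf d (3 ^ k) fun i => by
      have h := inWindow_of_le 0 k b (by rw [hk₂] at hk; exact hk) i
      simpa using h
  have hev : (fun k => (((n : ℝ) + 1) ^ d)⁻¹ * ∑ q ∈ B n b, w k (siteOf d ((n + 1) * 3 ^ k) q))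
      =ᶠ[atTop] (fun k => (((n : ℝ) + 1) ^ d)⁻¹ * ∑ z : Fin d → Fin (n + 1),
        ψ k (siteOf d (3 ^ k) b') (siteOf d ((n + 1) * 3 ^ k) (chart n (windowMap d (3 ^ k) (siteOf d (3 ^ k) b)) z))) := by
    refine Filter.eventually_atTop.2 ⟨max k₁ k₂, fun k hk => ?_⟩
    beta_reduce
    rw [hcol k ((le_max_left _ _).trans hk), hblock k ((le_max_right _ _).trans hk),
      sum_B b (fun q => w k (siteOf d ((n + 1) * 3 ^ k) q))]
  refine Tendsto.congr' hev ?_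
  exact (tendsto_finsetSum _ fun q _ => hlim q).const_mul _

/-! ## §3. THE END: the coarse floor in infinite volume -/

/-- **HEADLINE — THE INFINITE-VOLUME COARSE OPERATOR HAS [B6] (2.76)'s FLOOR**: `d ≥ 3`, `a > 0`, `λ < min(2,a)`, `Λ ≥ 0`, `V : ℤ^d → [−λ, Λ]`,
ANY bounded block columns `Ψ_{b′}` of `H_V` on `ℤ^d`, and every coarse `g : ℤ^d → ℝ` vanishing off a finite `S`:
`(1∕(36^d(4d + a + Λ)))·Σ_{b ∈ S} g b² ≤ Σ_{b ∈ S} g b·Σ_{b′ ∈ S}((n+1)^{−d}Σ_{q ∈ B n b}Ψ_{b′} q)·g b′` — (135) `coarse_floor` on every `T_k` for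
the window reading `g∘wm_k` (a statement about sums over `S` once `S` is inside the window, §1), and §2's convergence of the entries. [folklore] -/
theorem zd_coarse_floor (hd : 3 ≤ d) (a : ℝ) (ha : 0 < a) {lam Lam : ℝ} (hlam : lam < min 2 a) (hLam : 0 ≤ Lam)
    (n : ℕ) (V : X d → ℝ) (hV : ∀ p, -lam ≤ V p) (hV' : ∀ p, V p ≤ Lam)
    (Ψ : X d → X d → ℝ) (BΨ : X d → ℝ) (hΨB : ∀ b' p, |Ψ b' p| ≤ BΨ b')
    (hΨ : ∀ b' p, ((n : ℝ) + 1) ^ 2 * ∑ μ, (2 * Ψ b' p - Ψ b' (p + e μ) - Ψ b' (p - e μ))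
      + a / ((n : ℝ) + 1) ^ d * ∑ q ∈ B n (blk n p), Ψ b' q + V p * Ψ b' p = if blk n p = b' then 1 else 0)
    (S : Finset (X d)) (g : X d → ℝ) (hg : ∀ b, b ∉ S → g b = 0) :
    1 / ((36 : ℝ) ^ d * (4 * d + a + Lam)) * ∑ b ∈ S, g b ^ 2
      ≤ ∑ b ∈ S, g b * ∑ b' ∈ S, ((((n : ℝ) + 1) ^ d)⁻¹ * ∑ q ∈ B n b, Ψ b' q) * g b' := by
  classical
  have hm0 : 0 < min 2 a - lam := by linarith
  -- the torus block columns at every level and the floor there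
  choose ψ hψ using fun k : ℕ => exists_blockColumns n a (3 ^ k) ha.le hm0 (fun x => V (windowMap d ((n + 1) * 3 ^ k) x)) (fun x => hV _)
  have hfloor : ∀ k : ℕ, 1 / ((36 : ℝ) ^ d * (4 * d + a + Lam)) * ∑ y : Site d (3 ^ k), g (windowMap d (3 ^ k) y) ^ 2
      ≤ ∑ y : Site d (3 ^ k), g (windowMap d (3 ^ k) y) * ∑ y' : Site d (3 ^ k), ((((n : ℝ) + 1) ^ d)⁻¹ * ∑ z : Fin d → Fin (n + 1),
          ψ k y' (siteOf d ((n + 1) * 3 ^ k) (chart n (windowMap d (3 ^ k) y) z))) * g (windowMap d (3 ^ k) y') := fun k =>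
    coarse_floor n a (3 ^ k) ha hlam.le hLam (fun x => V (windowMap d ((n + 1) * 3 ^ k) x)) (fun x => hV _) (fun x => hV' _) (ψ k) (hψ k)
      (fun y => g (windowMap d (3 ^ k) y))
  -- beyond the window radius of `S`, both sides are sums over `S`
  set k₀ : ℕ := 2 * ∑ b ∈ S, ∑ i, (b i).natAbs + 1 with hk₀
  have hSwin : ∀ k, k₀ ≤ k → ∀ b ∈ S, windowMap d (3 ^ k) (siteOf d (3 ^ k) b) = b := fun k hk b hb =>
    windowMap_siteOf d (3 ^ k) fun i => by
      have hle : ∑ i, (b i).natAbs ≤ ∑ b ∈ S, ∑ i, (b i).natAbs :=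
        Finset.single_le_sum (f := fun b => ∑ i, (b i).natAbs) (fun _ _ => Nat.zero_le _) hb
      have h := inWindow_of_le 0 k b (by rw [hk₀] at hk; omega) i
      simpa using h
  have hLHS : ∀ k, k₀ ≤ k → ∑ y : Site d (3 ^ k), g (windowMap d (3 ^ k) y) ^ 2 = ∑ b ∈ S, g b ^ 2 := fun k hk =>
    sum_window_reading (3 ^ k) S (hSwin k hk) (fun b => g b ^ 2) fun b hb => by rw [hg b hb]; ring
  have hRHS : ∀ k, k₀ ≤ k → ∑ y : Site d (3 ^ k), g (windowMap d (3 ^ k) y) * ∑ y' : Site d (3 ^ k), ((((n : ℝ) + 1) ^ d)⁻¹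
        * ∑ z : Fin d → Fin (n + 1), ψ k y' (siteOf d ((n + 1) * 3 ^ k) (chart n (windowMap d (3 ^ k) y) z))) * g (windowMap d (3 ^ k) y')
      = ∑ b ∈ S, g b * ∑ b' ∈ S, ((((n : ℝ) + 1) ^ d)⁻¹ * ∑ z : Fin d → Fin (n + 1),
        ψ k (siteOf d (3 ^ k) b') (siteOf d ((n + 1) * 3 ^ k) (chart n (windowMap d (3 ^ k) (siteOf d (3 ^ k) b)) z))) * g b' := by
    intro k hk
    -- inner sums first
    have hinner : ∀ y : Site d (3 ^ k), ∑ y' : Site d (3 ^ k), ((((n : ℝ) + 1) ^ d)⁻¹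
        * ∑ z : Fin d → Fin (n + 1), ψ k y' (siteOf d ((n + 1) * 3 ^ k) (chart n (windowMap d (3 ^ k) y) z))) * g (windowMap d (3 ^ k) y')
        = ∑ b' ∈ S, ((((n : ℝ) + 1) ^ d)⁻¹ * ∑ z : Fin d → Fin (n + 1),
          ψ k (siteOf d (3 ^ k) b') (siteOf d ((n + 1) * 3 ^ k) (chart n (windowMap d (3 ^ k) y) z))) * g b' := by
      intro y
      have h := sum_window_reading (3 ^ k) S (hSwin k hk) (fun b' => ((((n : ℝ) + 1) ^ d)⁻¹ * ∑ z : Fin d → Fin (n + 1),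
          ψ k (siteOf d (3 ^ k) b') (siteOf d ((n + 1) * 3 ^ k) (chart n (windowMap d (3 ^ k) y) z))) * g b')
        (fun b' hb' => by simp only [hg b' hb', mul_zero])
      simp only [siteOf_windowMap] at h
      exact h
    simp only [hinner]
    have h := sum_window_reading (3 ^ k) S (hSwin k hk) (fun b => g b * ∑ b' ∈ S, ((((n : ℝ) + 1) ^ d)⁻¹ * ∑ z : Fin d → Fin (n + 1),
        ψ k (siteOf d (3 ^ k) b') (siteOf d ((n + 1) * 3 ^ k) (chart n (windowMap d (3 ^ k) (siteOf d (3 ^ k) b)) z))) * g b')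
      (fun b hb => by simp only [hg b hb, zero_mul])
    simp only [siteOf_windowMap] at h
    exact h
  -- the right-hand sides converge to the `ℤ^d` right-hand side
  have hT : Tendsto (fun k => ∑ b ∈ S, g b * ∑ b' ∈ S, ((((n : ℝ) + 1) ^ d)⁻¹ * ∑ z : Fin d → Fin (n + 1),
        ψ k (siteOf d (3 ^ k) b') (siteOf d ((n + 1) * 3 ^ k) (chart n (windowMap d (3 ^ k) (siteOf d (3 ^ k) b)) z))) * g b') atTop
      (𝓝 (∑ b ∈ S, g b * ∑ b' ∈ S, ((((n : ℝ) + 1) ^ d)⁻¹ * ∑ q ∈ B n b, Ψ b' q) * g b')) :=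
    tendsto_finsetSum _ fun b _ => (tendsto_finsetSum _ fun b' _ =>
      (zd_coarse_entry_tendsto hd a ha hlam hLam n V hV hV' Ψ BΨ hΨB hΨ ψ hψ b b').mul_const _).const_mul _
  refine ge_of_tendsto hT (Filter.eventually_atTop.2 ⟨k₀, fun k hk => ?_⟩)
  have h := hfloor k
  rw [hLHS k hk, hRHS k hk] at h
  exact h

/-! ## §4. Toy -/

/-- Toy (`d = 3`, `a = 1`, `λ = 0`, `Λ = 1`): the constants of the entry decay exist. -/
example : ∃ C δ : ℝ, 0 < C ∧ 0 < δ :=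
  let ⟨C, δ, hC, hδ, _⟩ := zd_coarse_entry_decay (d := 3) le_rfl 1 one_pos (lam := 0) (Lam := 1)
    (by rw [min_eq_right (by norm_num : (1 : ℝ) ≤ 2)]; norm_num) zero_le_one
  ⟨C, δ, hC, hδ⟩

end Summit.QuantumFields.BalabanUV.T4Continuum.NE7b.SupZdCoarseOperator
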